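import Summits.AtomisticToContinuum.FouriersLaw.Theorems.BondHeatUncertaintyExtensiveSnapshotIrreversibilityNessDensityPos
import HarnessLib

/-!
# Crux `ExtensiveSnapshotIrreversibility` (stmt-AtomisticToContinuum-9121), line `hellinger-logmean`:
stub S_H1 `stub_oddLogDensitySandwich` — helper file 1 (the real-analysis assembly)

Support lemmas for the registered stub S_H1 of the lead's checked skeleton v3 of the line: the two-sided
`o(1)·(1+H)` envelope of the ODD log-ratio `d_δ = log ρ_δ − log ρ_δ∘Θ` of the Lebesgue density `ρ_δ` of the
two-temperature steady state `μ_δ = μ_{N,T+δ/2,T−δ/2}` of the pinned anharmonic chain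
`P = pinnedChain ω₂ lam β γ` (`Θ(q, p) = (q, −p)` the momentum flip, `H = P.hamiltonian N`).

What is proved here (no new analysis; the two analytic inputs of S_H1 are HYPOTHESES of the final theorem):

* `abs_log_sub_log_le_of_even_ref` — the pointwise core: if `|log u + w| ≤ A + η' h` and `|log v + w| ≤ A + η' h`
  (the SAME even reference value `w`, e.g. `H(x)/T = H(Θx)/T`), then `|log u − log v| ≤ 2A + 2η' h`;
* `abs_log_sub_log_le_of_sandwich` — the Gibbs-sandwich form: `c e^{−a h} ≤ u, v ≤ C e^{−b h}`, `b ≤ a`, give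
  `|log u − log v| ≤ (log C − log c) + (a − b) h`;
* `envelope_of_far_and_near` — the split of phase space into `{H ≥ R}` / `{H ≤ R}`: a bound `L + η h` with
  `L ≤ η R` far out and a bound `2η` on the sublevel set give `2η(1 + h)` everywhere;
* `lintegral_density_eq_one` — a represented steady state has a probability density (`∫ ρ = 1`);
* `helper_oddSandwichDensityFamily` (registered helper) — the CANONICAL density family: along every steady-state
  family, for `T > 0`, `N ≥ 1`, ONE function `ρ : ℝ → PhaseSpace N → ℝ`, each `ρ δ` smooth, measurable and
  everywhere positive, representing `μ_δ` with `∫ ρ_δ = 1` for every `|δ| < 2T` (assembly of the landed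
  `LogDensity.ness_density_pos`, p115843, by choice over `δ`);
* `helper_oddSandwichOfEvenRef` (registered helper) — **S_H1 from its two analytic inputs, general form**: a
  `δ`-UNIFORM two-sided bound `|log ρ_δ + W_δ| ≤ A + η' H` against SOME `Θ`-even reference `W_δ` (e.g. `H/T`, or
  `H/T_eff(δ)`), available for every `η' > 0`, and the local uniform smallness of `d_δ` on energy sublevel sets
  `{H ≤ R}` as `δ → 0`, give the conclusion of S_H1 for that family, with
  `δ₀ = min(T, δ_ref(η/2), δ_local(R, 2η))`, `R = 2A/η`;
* `helper_oddSandwichOfTwoSided` (registered helper) — the same from the two-sided GIBBS sandwich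
  `c e^{−(1/T+η')H} ≤ ρ_δ ≤ C e^{−(1/T−η')H}` (`NessLogDensityTwoSided`, not in print for the direct-Langevin
  chain): `W = H/T`, `A = max |log c| |log C|`.

References (recon memo `work/stubs/S_H1-recon.md`): L. Rey-Bellet, L. E. Thomas, CMP 215 (2000) 1–24, Thm 1.4 and
Remark 1.5 (low-temperature two-sided sandwich of the rate function, EPR model); J.-P. Eckmann, C.-A. Pillet,
L. Rey-Bellet, CMP 201 (1999) 657–697, §3 (`h e^{βG} ∈ 𝒮`, `β < min(β_L, β_R)`: upper half, EPR model);
N. Cuneo, J.-P. Eckmann, M. Hairer, L. Rey-Bellet, EJP 23 (2018) no. 55, Thm 2.13.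
-/

noncomputable section

namespace Summit.AtomisticToContinuum.FouriersLaw.Theorems.ExtensiveSnapshotIrreversibility.HellingerLogMean

open MeasureTheory Filter Topology
open scoped ENNReal NNReal
open Literature.MathematicalPhysics.KineticTheory.HeatConduction
open Summit.AtomisticToContinuum.FouriersLaw.Theorems.ExtensiveSnapshotIrreversibility.ClausiusBudget

/-! ## 1. Pointwise real-analysis core -/

/-- **Odd log-ratio from a two-sided bound against an EVEN reference.** If `|log u + w| ≤ A + η' h` and
`|log v + w| ≤ A + η' h` for the same reference value `w` (the value of a `Θ`-even function at `x` and at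
`Θ x`), then `|log u − log v| ≤ 2A + 2η' h`. [folklore] -/
theorem abs_log_sub_log_le_of_even_ref {u v w A η' h : ℝ} (hu : |Real.log u + w| ≤ A + η' * h)
    (hv : |Real.log v + w| ≤ A + η' * h) :
    |Real.log u - Real.log v| ≤ 2 * A + 2 * (η' * h) := by
  have h1 := abs_le.1 hu
  have h2 := abs_le.1 hv
  rw [abs_le]
  constructor <;> linarith [h1.1, h1.2, h2.1, h2.2]

/-- **Odd log-ratio from a two-sided Gibbs sandwich.** If `c e^{−a h} ≤ u ≤ C e^{−b h}` and
`c e^{−a h} ≤ v ≤ C e^{−b h}` with `c > 0`, then `|log u − log v| ≤ (log C − log c) + (a − b) h`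
(no sign condition on `h` or `a − b` is needed). [folklore] -/
theorem abs_log_sub_log_le_of_sandwich {u v c C a b h : ℝ} (hc : 0 < c)
    (hu₁ : c * Real.exp (-(a * h)) ≤ u) (hu₂ : u ≤ C * Real.exp (-(b * h)))
    (hv₁ : c * Real.exp (-(a * h)) ≤ v) (hv₂ : v ≤ C * Real.exp (-(b * h))) :
    |Real.log u - Real.log v| ≤ (Real.log C - Real.log c) + (a - b) * h := by
  have hlow : 0 < c * Real.exp (-(a * h)) := mul_pos hc (Real.exp_pos _)
  have hu0 : 0 < u := hlow.trans_le hu₁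
  have hv0 : 0 < v := hlow.trans_le hv₁
  have hC0 : 0 < C := by
    have hpos := hu0.trans_le hu₂
    by_contra hC
    have hC' : C ≤ 0 := not_lt.1 hC
    have : C * Real.exp (-(b * h)) ≤ 0 := mul_nonpos_of_nonpos_of_nonneg hC' (Real.exp_pos _).le
    linarith
  have hlogu₁ : Real.log c - a * h ≤ Real.log u := by
    have := Real.log_le_log hlow hu₁
    rwa [Real.log_mul hc.ne' (Real.exp_pos _).ne', Real.log_exp] at this
  have hlogv₁ : Real.log c - a * h ≤ Real.log v := by
    have := Real.log_le_log hlow hv₁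
    rwa [Real.log_mul hc.ne' (Real.exp_pos _).ne', Real.log_exp] at this
  have hlogu₂ : Real.log u ≤ Real.log C - b * h := by
    have := Real.log_le_log hu0 hu₂
    rwa [Real.log_mul hC0.ne' (Real.exp_pos _).ne', Real.log_exp] at this
  have hlogv₂ : Real.log v ≤ Real.log C - b * h := by
    have := Real.log_le_log hv0 hv₂
    rwa [Real.log_mul hC0.ne' (Real.exp_pos _).ne', Real.log_exp] at this
  rw [abs_le]
  constructor <;> nlinarith

/-- **The far/near split.** If a quantity `d` obeys `|d| ≤ L + η h` with `h ≥ 0`, and EITHER `h ≥ R` with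
`L ≤ η R`, OR `|d| ≤ 2η`, then `|d| ≤ 2(η(1 + h))`. [folklore] -/
theorem envelope_of_far_and_near {d L η h R : ℝ} (hη : 0 ≤ η) (hh : 0 ≤ h) (hfar : |d| ≤ L + η * h)
    (hLR : L ≤ η * R) (hsplit : R ≤ h ∨ |d| ≤ 2 * η) : |d| ≤ 2 * (η * (1 + h)) := by
  rcases hsplit with hRh | hnear
  · have h1 : L ≤ η * h := hLR.trans (mul_le_mul_of_nonneg_left hRh hη)
    nlinarith
  · nlinarith [mul_nonneg hη hh]

/-! ## 2. Measure-theoretic bookkeeping -/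

/-- A steady state represented by a nonnegative Lebesgue density has total mass one:
`∫⁻ ρ dLeb = μ(univ) = 1`. [folklore] -/
theorem lintegral_density_eq_one {N : ℕ} {P : OscillatorChain} {T_L T_R : ℝ} {μ : Measure (PhaseSpace N)}
    (hμ : P.IsSteadyState N T_L T_R μ) {ρ : PhaseSpace N → ℝ}
    (hrep : μ = (volume : Measure (PhaseSpace N)).withDensity fun x => ENNReal.ofReal (ρ x)) :
    (∫⁻ x, ENNReal.ofReal (ρ x) ∂(volume : Measure (PhaseSpace N))) = 1 := by
  haveI : IsProbabilityMeasure μ := hμ.1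
  have h : ((volume : Measure (PhaseSpace N)).withDensity fun x => ENNReal.ofReal (ρ x)) Set.univ = 1 := by
    rw [← hrep, measure_univ]
  rwa [withDensity_apply _ MeasurableSet.univ, Measure.restrict_univ] at h

/-- From an `eventually` statement along `δ → 0`, `δ ≠ 0` to an explicit punctured window. [folklore] -/
theorem exists_window_of_eventually {p : ℝ → Prop} (h : ∀ᶠ δ in 𝓝[≠] (0 : ℝ), p δ) :
    ∃ δ₁ : ℝ, 0 < δ₁ ∧ ∀ δ : ℝ, δ ≠ 0 → |δ| < δ₁ → p δ := by
  rw [eventually_nhdsWithin_iff, Metric.eventually_nhds_iff] at h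
  obtain ⟨ε, hε, hball⟩ := h
  refine ⟨ε, hε, fun δ hδ hδε => hball ?_ hδ⟩
  simpa [Real.dist_eq] using hδε

/-! ## 3. The canonical density family (registered helper) -/

/-- **The canonical NESS density family** (registered helper `helper_oddSandwichDensityFamily` for S_H1, line
`hellinger-logmean`). Along every steady-state family `μ` of the pinned chain (all parameters `> 0`), for
`T > 0` and `N ≥ 1` there is ONE `ρ : ℝ → PhaseSpace N → ℝ` with every `ρ δ` smooth, measurable and everywhere
positive, such that for every `|δ| < 2T` the two-temperature steady state is `ρ_δ · Leb` and `∫ ρ_δ = 1`.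
Choice over `δ` of the landed `LogDensity.ness_density_pos` (junk value `1` for `|δ| ≥ 2T`). [folklore] -/
theorem helper_oddSandwichDensityFamily :
    ∀ ω₂ lam β γ : ℝ, 0 < ω₂ → 0 < lam → 0 < β → 0 < γ →
      ∀ μ : (N : ℕ) → ℝ → ℝ → Measure (PhaseSpace N),
        (∀ (N : ℕ) (T_L T_R : ℝ), 0 < T_L → 0 < T_R →
          (pinnedChain ω₂ lam β γ).IsSteadyState N T_L T_R (μ N T_L T_R)) →
        ∀ T : ℝ, 0 < T → ∀ N : ℕ, 0 < N →
          ∃ ρ : ℝ → PhaseSpace N → ℝ,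
            (∀ δ, ContDiff ℝ (⊤ : ℕ∞) (ρ δ)) ∧ (∀ δ, Measurable (ρ δ)) ∧ (∀ δ x, 0 < ρ δ x) ∧
            ∀ δ : ℝ, |δ| < 2 * T →
              μ N (T + δ / 2) (T - δ / 2) =
                (volume : Measure (PhaseSpace N)).withDensity (fun x => ENNReal.ofReal (ρ δ x)) ∧
              (∫⁻ x, ENNReal.ofReal (ρ δ x) ∂(volume : Measure (PhaseSpace N))) = 1 := by
  intro ω₂ lam β γ hω hl hβ hγ μ hμ T hT N hN
  have key : ∀ δ : ℝ, ∃ r : PhaseSpace N → ℝ, ContDiff ℝ (⊤ : ℕ∞) r ∧ (∀ x, 0 < r x) ∧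
      (|δ| < 2 * T → μ N (T + δ / 2) (T - δ / 2) =
        (volume : Measure (PhaseSpace N)).withDensity (fun x => ENNReal.ofReal (r x))) := by
    intro δ
    by_cases hδ : |δ| < 2 * T
    · have h1 := abs_lt.1 hδ
      have hL : 0 < T + δ / 2 := by linarith [h1.1]
      have hR : 0 < T - δ / 2 := by linarith [h1.2]
      obtain ⟨r, hrs, hrpos, hμr⟩ := LogDensity.ness_density_pos ω₂ lam β γ hω hl hβ hγ N hN (T + δ / 2)
        (T - δ / 2) hL hR (μ N (T + δ / 2) (T - δ / 2)) (hμ N _ _ hL hR)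
      exact ⟨r, hrs, hrpos, fun _ => hμr⟩
    · exact ⟨fun _ => 1, contDiff_const, fun _ => one_pos, fun h => absurd h hδ⟩
  choose ρ hρs hρpos hρeq using key
  refine ⟨ρ, hρs, fun δ => (hρs δ).continuous.measurable, hρpos, fun δ hδ => ⟨hρeq δ hδ, ?_⟩⟩
  have h1 := abs_lt.1 hδ
  have hL : 0 < T + δ / 2 := by linarith [h1.1]
  have hR : 0 < T - δ / 2 := by linarith [h1.2]
  exact lintegral_density_eq_one (hμ N _ _ hL hR) (hρeq δ hδ)

/-! ## 4. S_H1 from an even reference / from the two-sided sandwich (registered helpers) -/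

/-- **S_H1 from a two-sided bound against an even reference** (registered helper `helper_oddSandwichOfEvenRef`,
line `hellinger-logmean`; the most general form of the assembly). Along every steady-state family `μ` of the
pinned chain (all parameters `> 0`), `T > 0`, any `N`, for a density family `ρ` (measurable, everywhere positive,
representing `μ_{N,T+δ/2,T−δ/2}` for `0 < |δ| < δ₁`): IF for every `η' > 0` there are `δ(η') > 0` and a
`δ`-UNIFORM constant `A` such that for `0 < |δ| < δ(η')` some `Θ`-EVEN reference `W_δ` (e.g. `H/T`, or `H/T_eff(δ)`)
satisfies `|log ρ_δ + W_δ| ≤ A + η' H` everywhere, AND the odd log-ratio is eventually uniformly small on every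
energy sublevel set `{H ≤ R}`, THEN for every `η > 0` there is `δ₀ > 0` such that for `0 < |δ| < δ₀`:
`μ_δ = ρ_δ·Leb`, `∫ ρ_δ = 1` and `|log ρ_δ(x) − log ρ_δ(Θx)| ≤ 2η(1 + H(x))` for all `x`.
Split `{H ≥ R}` (reference bound at `η' = η/2`, `R = 2A/η`) / `{H ≤ R}` (local smallness at `ε = 2η`). [folklore] -/
theorem helper_oddSandwichOfEvenRef :
    ∀ ω₂ lam β γ : ℝ, 0 < ω₂ → 0 < lam → 0 < β → 0 < γ →
      ∀ μ : (N : ℕ) → ℝ → ℝ → Measure (PhaseSpace N),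
        (∀ (N : ℕ) (T_L T_R : ℝ), 0 < T_L → 0 < T_R →
          (pinnedChain ω₂ lam β γ).IsSteadyState N T_L T_R (μ N T_L T_R)) →
        ∀ T : ℝ, 0 < T → ∀ N : ℕ, ∀ ρ : ℝ → PhaseSpace N → ℝ,
          (∀ δ, Measurable (ρ δ)) → (∀ δ x, 0 < ρ δ x) →
          (∃ δ₁ : ℝ, 0 < δ₁ ∧ ∀ δ : ℝ, δ ≠ 0 → |δ| < δ₁ →
            μ N (T + δ / 2) (T - δ / 2) =
              (volume : Measure (PhaseSpace N)).withDensity (fun x => ENNReal.ofReal (ρ δ x))) →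
          (∀ η' : ℝ, 0 < η' → ∃ δ₁ A : ℝ, 0 < δ₁ ∧ ∀ δ : ℝ, δ ≠ 0 → |δ| < δ₁ →
            ∃ W : PhaseSpace N → ℝ, (∀ x : PhaseSpace N, W (x.1, -x.2) = W x) ∧
              ∀ x : PhaseSpace N, |Real.log (ρ δ x) + W x| ≤
                A + η' * (pinnedChain ω₂ lam β γ).hamiltonian N x) →
          (∀ R ε : ℝ, 0 < ε → ∀ᶠ δ in 𝓝[≠] (0 : ℝ), ∀ x : PhaseSpace N,
            (pinnedChain ω₂ lam β γ).hamiltonian N x ≤ R →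
              |Real.log (ρ δ x) - Real.log (ρ δ (x.1, -x.2))| ≤ ε) →
          ∀ η : ℝ, 0 < η → ∃ δ₀ : ℝ, 0 < δ₀ ∧ ∀ δ : ℝ, δ ≠ 0 → |δ| < δ₀ →
            μ N (T + δ / 2) (T - δ / 2) =
              (volume : Measure (PhaseSpace N)).withDensity (fun x => ENNReal.ofReal (ρ δ x)) ∧
            (∫⁻ x, ENNReal.ofReal (ρ δ x) ∂(volume : Measure (PhaseSpace N))) = 1 ∧
            ∀ x : PhaseSpace N, |Real.log (ρ δ x) - Real.log (ρ δ (x.1, -x.2))| ≤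
              2 * (η * (1 + (pinnedChain ω₂ lam β γ).hamiltonian N x)) := by
  intro ω₂ lam β γ hω hl hβ hγ μ hμ T hT N ρ _hρm _hρpos hrep href hloc η hη
  set P := pinnedChain ω₂ lam β γ with hP
  have hHnn : ∀ x : PhaseSpace N, 0 ≤ P.hamiltonian N x := fun x =>
    pinnedChain_hamiltonian_nonneg hω.le hl.le hβ.le γ N x
  have hHΘ : ∀ x : PhaseSpace N, P.hamiltonian N (x.1, -x.2) = P.hamiltonian N x := fun x =>
    OscillatorChain.hamiltonian_neg_momentum P N x
  -- the representation window
  obtain ⟨δr, hδr, hrepr⟩ := hrep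
  -- the reference bound at `η' = η/2`
  obtain ⟨δs, A, hδs, hsw⟩ := href (η / 2) (by positivity)
  -- the far/near threshold and the local window at `ε = 2η`
  set L : ℝ := 2 * A with hL
  set R : ℝ := L / η with hR
  obtain ⟨δl, hδl, hlw⟩ := exists_window_of_eventually (hloc R (2 * η) (by positivity))
  refine ⟨min (min T δr) (min δs δl), lt_min (lt_min hT hδr) (lt_min hδs hδl), fun δ hδ0 hδ => ?_⟩
  have hδT : |δ| < T := (lt_min_iff.1 (lt_min_iff.1 hδ).1).1
  have hδr' : |δ| < δr := (lt_min_iff.1 (lt_min_iff.1 hδ).1).2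
  have hδs' : |δ| < δs := (lt_min_iff.1 (lt_min_iff.1 hδ).2).1
  have hδl' : |δ| < δl := (lt_min_iff.1 (lt_min_iff.1 hδ).2).2
  have h1 := abs_lt.1 hδT
  have hLpos : 0 < T + δ / 2 := by linarith [h1.1]
  have hRpos : 0 < T - δ / 2 := by linarith [h1.2]
  have hrepδ := hrepr δ hδ0 hδr'
  refine ⟨hrepδ, lintegral_density_eq_one (hμ N _ _ hLpos hRpos) hrepδ, fun x => ?_⟩
  -- far: the reference bound at `x` and at `Θ x` (same reference value `W x`)
  obtain ⟨W, hWΘ, hW⟩ := hsw δ hδ0 hδs'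
  have hx := hW x
  have hy := hW (x.1, -x.2)
  rw [hWΘ x, hHΘ x] at hy
  have hfar : |Real.log (ρ δ x) - Real.log (ρ δ (x.1, -x.2))| ≤ L + η * P.hamiltonian N x := by
    have h := abs_log_sub_log_le_of_even_ref hx hy
    have e : 2 * (η / 2 * P.hamiltonian N x) = η * P.hamiltonian N x := by ring
    rwa [e] at h
  have hLR : L ≤ η * R := by
    rw [hR, mul_div_cancel₀ _ hη.ne']
  -- near: the local smallness on `{H ≤ R}`
  refine envelope_of_far_and_near hη.le (hHnn x) hfar hLR ?_
  rcases le_or_gt R (P.hamiltonian N x) with hRx | hRx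
  · exact Or.inl hRx
  · exact Or.inr (hlw δ hδ0 hδl' x hRx.le)

/-- From a two-sided Gibbs sandwich `c e^{−(1/T+η')H} ≤ ρ ≤ C e^{−(1/T−η')H}` (`c > 0`) to the bound
`|log ρ + H/T| ≤ max |log c| |log C| + η' H` against the even reference `H/T`. [folklore] -/
theorem abs_log_add_ref_le_of_sandwich {u c C T η' h : ℝ} (hc : 0 < c)
    (hu₁ : c * Real.exp (-((1 / T + η') * h)) ≤ u) (hu₂ : u ≤ C * Real.exp (-((1 / T - η') * h))) :
    |Real.log u + h / T| ≤ max |Real.log c| |Real.log C| + η' * h := by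
  have hlow : 0 < c * Real.exp (-((1 / T + η') * h)) := mul_pos hc (Real.exp_pos _)
  have hu0 : 0 < u := hlow.trans_le hu₁
  have hC0 : 0 < C := by
    have hpos := hu0.trans_le hu₂
    by_contra hC
    have hC' : C ≤ 0 := not_lt.1 hC
    have : C * Real.exp (-((1 / T - η') * h)) ≤ 0 :=
      mul_nonpos_of_nonpos_of_nonneg hC' (Real.exp_pos _).le
    linarith
  have hlog₁ : Real.log c - (1 / T + η') * h ≤ Real.log u := by
    have := Real.log_le_log hlow hu₁
    rwa [Real.log_mul hc.ne' (Real.exp_pos _).ne', Real.log_exp] at this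
  have hlog₂ : Real.log u ≤ Real.log C - (1 / T - η') * h := by
    have := Real.log_le_log hu0 hu₂
    rwa [Real.log_mul hC0.ne' (Real.exp_pos _).ne', Real.log_exp] at this
  have hc' : -max |Real.log c| |Real.log C| ≤ Real.log c :=
    (neg_le_neg (le_max_left _ _)).trans (neg_abs_le _)
  have hC' : Real.log C ≤ max |Real.log c| |Real.log C| := (le_abs_self _).trans (le_max_right _ _)
  have e : (1 / T + η') * h = h / T + η' * h := by ring
  have e' : (1 / T - η') * h = h / T - η' * h := by ring
  rw [e] at hlog₁
  rw [e'] at hlog₂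
  rw [abs_le]
  constructor <;> linarith

/-- **S_H1 from its two analytic inputs** (registered helper `helper_oddSandwichOfTwoSided`, line `hellinger-logmean`).
Along every steady-state family `μ` of the pinned chain (all parameters `> 0`), `T > 0`, any `N`, for a density
family `ρ` (measurable, everywhere positive, representing `μ_{N,T+δ/2,T−δ/2}` for `0 < |δ| < δ₁`): IF for every
`η' > 0` there are `δ`-UNIFORM constants `0 < c`, `C` with the two-sided Gibbs sandwich
`c e^{−(1/T+η')H} ≤ ρ_δ ≤ C e^{−(1/T−η')H}` for `0 < |δ| < δ(η')` (`NessLogDensityTwoSided`, not in print for the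
direct-Langevin chain), AND the odd log-ratio is eventually uniformly small on every energy sublevel set `{H ≤ R}`,
THEN for every `η > 0` there is `δ₀ > 0` such that for `0 < |δ| < δ₀`: `μ_δ = ρ_δ·Leb`, `∫ ρ_δ = 1` and
`|log ρ_δ(x) − log ρ_δ(Θx)| ≤ 2η(1 + H(x))` for all `x`. Reduction to `helper_oddSandwichOfEvenRef` with the even
reference `W = H/T`, `A = max |log c| |log C|`. [folklore] -/
theorem helper_oddSandwichOfTwoSided :
    ∀ ω₂ lam β γ : ℝ, 0 < ω₂ → 0 < lam → 0 < β → 0 < γ →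
      ∀ μ : (N : ℕ) → ℝ → ℝ → Measure (PhaseSpace N),
        (∀ (N : ℕ) (T_L T_R : ℝ), 0 < T_L → 0 < T_R →
          (pinnedChain ω₂ lam β γ).IsSteadyState N T_L T_R (μ N T_L T_R)) →
        ∀ T : ℝ, 0 < T → ∀ N : ℕ, ∀ ρ : ℝ → PhaseSpace N → ℝ,
          (∀ δ, Measurable (ρ δ)) → (∀ δ x, 0 < ρ δ x) →
          (∃ δ₁ : ℝ, 0 < δ₁ ∧ ∀ δ : ℝ, δ ≠ 0 → |δ| < δ₁ →
            μ N (T + δ / 2) (T - δ / 2) =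
              (volume : Measure (PhaseSpace N)).withDensity (fun x => ENNReal.ofReal (ρ δ x))) →
          (∀ η' : ℝ, 0 < η' → ∃ δ₁ c C : ℝ, 0 < δ₁ ∧ 0 < c ∧ ∀ δ : ℝ, δ ≠ 0 → |δ| < δ₁ →
            ∀ x : PhaseSpace N,
              c * Real.exp (-((1 / T + η') * (pinnedChain ω₂ lam β γ).hamiltonian N x)) ≤ ρ δ x ∧
              ρ δ x ≤ C * Real.exp (-((1 / T - η') * (pinnedChain ω₂ lam β γ).hamiltonian N x))) →
          (∀ R ε : ℝ, 0 < ε → ∀ᶠ δ in 𝓝[≠] (0 : ℝ), ∀ x : PhaseSpace N,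
            (pinnedChain ω₂ lam β γ).hamiltonian N x ≤ R →
              |Real.log (ρ δ x) - Real.log (ρ δ (x.1, -x.2))| ≤ ε) →
          ∀ η : ℝ, 0 < η → ∃ δ₀ : ℝ, 0 < δ₀ ∧ ∀ δ : ℝ, δ ≠ 0 → |δ| < δ₀ →
            μ N (T + δ / 2) (T - δ / 2) =
              (volume : Measure (PhaseSpace N)).withDensity (fun x => ENNReal.ofReal (ρ δ x)) ∧
            (∫⁻ x, ENNReal.ofReal (ρ δ x) ∂(volume : Measure (PhaseSpace N))) = 1 ∧
            ∀ x : PhaseSpace N, |Real.log (ρ δ x) - Real.log (ρ δ (x.1, -x.2))| ≤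
              2 * (η * (1 + (pinnedChain ω₂ lam β γ).hamiltonian N x)) := by
  intro ω₂ lam β γ hω hl hβ hγ μ hμ T hT N ρ hρm hρpos hrep hsand hloc
  refine helper_oddSandwichOfEvenRef ω₂ lam β γ hω hl hβ hγ μ hμ T hT N ρ hρm hρpos hrep ?_ hloc
  intro η' hη'
  obtain ⟨δ₁, c, C, hδ₁, hc, hsw⟩ := hsand η' hη'
  refine ⟨δ₁, max |Real.log c| |Real.log C|, hδ₁, fun δ hδ0 hδ => ?_⟩
  refine ⟨fun x => (pinnedChain ω₂ lam β γ).hamiltonian N x / T, fun x => ?_, fun x => ?_⟩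
  · simp only [OscillatorChain.hamiltonian_neg_momentum]
  · obtain ⟨h₁, h₂⟩ := hsw δ hδ0 hδ x
    exact abs_log_add_ref_le_of_sandwich hc h₁ h₂

end Summit.AtomisticToContinuum.FouriersLaw.Theorems.ExtensiveSnapshotIrreversibility.HellingerLogMean

end
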